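import Literature.AlgebraicGeometry.Morphisms.CompactificationGluingPiece
import Literature.AlgebraicGeometry.Resolution.IsoNearClosure
import Literature.AlgebraicGeometry.Resolution.StrictTransformImage
import HarnessLib

/-!
# The image `X₁₂` of `V₁ ×_U V₂ → X₁ ×_S X₂` in the two-piece compactification (Stacks 0F40)

Topic: `Literature/AlgebraicGeometry/Morphisms`. The middle part of the proof of The Stacks
Project, Tag 0F40 (More on Flatness, Lemma 38.33.7; the two-piece induction step of Nagata's
compactification theorem, Tag 0F41), for extension data `E₁ : ExtData g U₁`, `E₂ : ExtData g U₂`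
(`CompactificationGluingPiece.lean`) of the two opens `U₁ ∪ U₂ = U`:

> "Set `V₁₂ = V₁ ×_U V₂`. We have an immersion `V₁₂ → X₁ ×_S X₂` […]. Let `X₁₂ ⊂ X₁ ×_S X₂` be
> the scheme theoretic image of `V₁₂ → X₁ ×_S X₂`. The projection morphisms `p₁ : X₁₂ → X₁` and
> `p₂ : X₁₂ → X₂` are proper […]. The morphism `p₁|_{V₁₂} : V₁₂ → V₁` is an isomorphism over an
> open neighbourhood of `Z₁,₂` because `ψ₂ : V₂ → U` is an isomorphism over an open neighbourhood
> of `Z₂` and `V₁₂ = V₁ ×_U V₂`. By Lemma 0F3W there exists a `V₁`-admissible blowing up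
> `X₁' → X₁` such that the strict transform `p₁' : X₁₂' → X₁'` of `p₁` is an isomorphism over an
> open neighbourhood of the closure of `Z₁,₂` in `X₁'`. […] The reduction of the previous
> paragraph tells us that `X₁₂ ∩ (Z̄₁,₂ ×_S Z̄₂,₁) = ∅`."

PROVED here (conditionally on `Stacks081R` through Tags 0F3V/0F3W/0F3Z), in the form consumed by
the valuative argument of the last part of the proof (`TwoPieceCompactification.lean`):

* `ExtData.pairMap E₁ E₂ : V₁ ×_U V₂ → X₁ ×_S X₂` and its scheme-theoretic image;
  `isIso_fst_restrict_of_section` / `ExtData.isIso_p₁_restrict` — `p₁ : X₁₂ → X₁` is an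
  isomorphism over `N₁ = V₁.ι(ψ₁⁻¹ U₂) ⊇ Z₁,₂` (the section `N₁ ≅ V₁₂|_{N₁} → X₁₂|_{N₁}` is
  scheme-theoretically dominant);
* `ExtData.exists_separating` — Tag 0F3V: after a `Vᵢ`-admissible blowing up, the closures of
  `Zᵢ,ᵢ = ψᵢ⁻¹(U ∖ Uⱼ)` and `Zᵢ,ⱼ = ψᵢ⁻¹(U ∖ Uᵢ)` are disjoint;
* `ExtData.exists_isIso_near` — Tag 0F3W + Tag 0F3Y: after a further `V₁`-admissible blowing up,
  `p₁` is an isomorphism over an open neighbourhood of `Z̄₁,₂`;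
* `ExtData.pair_empty` — **`X₁₂ ∩ (Z̄₁,₂ ×_S Z̄₂,₁) = ∅`**; `ExtData.exists_goodPair` — the two
  reductions combined: extension data `F₁, F₂` (obtained from any `E₁, E₂` by admissible blowing
  ups) for which this emptiness holds.

## References

* The Stacks Project, Tag 0F40 (Lemma 38.33.7), proof; Tags 0F3V, 0F3W, 0F3Y. [StacksProject]
-/

noncomputable section

-- Mathlib's pull-back API is stated through `abbrev`s over `limit`; as in Mathlib's own
-- algebraic-geometry files we let `simp`/unification see through them.
set_option backward.isDefEq.respectTransparency false

universe u

open CategoryTheory CategoryTheory.Limits AlgebraicGeometry TopologicalSpace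
open Literature.AlgebraicGeometry.Resolution

namespace Literature.AlgebraicGeometry.Morphisms

/-! ## A separated morphism with a schematically dense section of `π⁻¹(N) → N` is an isomorphism over `N` -/

/-- If `π : X' → X` is separated and `h : N → π⁻¹(N)` is a scheme-theoretically dominant section
of `π|_N`, then `π` is an isomorphism over `N` (the section is a closed immersion with trivial
kernel). [cite: GortzWedhorn2020, Thm 13.100 (proof, Step 3)] -/
theorem isIso_morphismRestrict_of_section' {X X' : Scheme.{u}} (π : X' ⟶ X) [IsSeparated π]
    (N : X.Opens) (h : (N : Scheme.{u}) ⟶ ↑(π ⁻¹ᵁ N)) (w : h ≫ (π ∣_ N) = 𝟙 _)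
    [IsSchemeTheoreticallyDominant h] : IsIso (π ∣_ N) := by
  haveI : IsClosedImmersion h := by
    have : IsClosedImmersion (h ≫ (π ∣_ N)) := by rw [w]; infer_instance
    exact IsClosedImmersion.of_comp h (π ∣_ N)
  haveI : IsIso h := IsClosedImmersion.isIso_iff_ker_eq_bot.mpr (IsSchemeTheoreticallyDominant.ker_eq_bot _)
  have : π ∣_ N = inv h ≫ (h ≫ (π ∣_ N)) := by simp
  rw [this, w]
  infer_instance

/-- The restriction of a quasi-compact scheme-theoretically dominant morphism over an open of the
target is scheme-theoretically dominant. [folklore] -/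
theorem IsSchemeTheoreticallyDominant.morphismRestrict {X Y : Scheme.{u}} (f : X ⟶ Y) [QuasiCompact f]
    [IsSchemeTheoreticallyDominant f] (W : Y.Opens) : IsSchemeTheoreticallyDominant (f ∣_ W) :=
  ⟨by rw [ker_morphismRestrict_eq_comap, IsSchemeTheoreticallyDominant.ker_eq_bot,
    Scheme.IdealSheafData.comap_bot]⟩

namespace ExtData

variable {U S : Scheme.{u}} {g : U ⟶ S} {U₁ U₂ : U.Opens} (E₁ : ExtData g U₁) (E₂ : ExtData g U₂)

/-! ## `V₁₂ = V₁ ×_U V₂ → X₁ ×_S X₂` and its image `X₁₂` -/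

/-- `V₁₂ = V₁ ×_U V₂ → X₁ ×_S X₂`. [cite: StacksProject, Tag 0F40 (proof)] -/
def pairMap : pullback E₁.ψ E₂.ψ ⟶ pullback E₁.πX E₂.πX :=
  pullback.map E₁.ψ E₂.ψ E₁.πX E₂.πX E₁.V.ι E₂.V.ι g E₁.ψ_g E₂.ψ_g

/-- `V₁₂ → X₁ ×_S X₂ → X₁` is `V₁₂ → V₁ ↪ X₁`. [folklore] -/
@[reassoc (attr := simp)]
theorem pairMap_fst : pairMap E₁ E₂ ≫ pullback.fst E₁.πX E₂.πX = pullback.fst E₁.ψ E₂.ψ ≫ E₁.V.ι :=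
  pullback.lift_fst _ _ _

/-- `V₁₂ → X₁ ×_S X₂ → X₂` is `V₁₂ → V₂ ↪ X₂`. [folklore] -/
@[reassoc (attr := simp)]
theorem pairMap_snd : pairMap E₁ E₂ ≫ pullback.snd E₁.πX E₂.πX = pullback.snd E₁.ψ E₂.ψ ≫ E₂.V.ι :=
  pullback.lift_snd _ _ _

/-- The first projection `p₁ : X₁₂ → X₁` of the scheme-theoretic image. [cite: StacksProject, Tag 0F40 (proof)] -/
def p₁ : (pairMap E₁ E₂).image ⟶ E₁.X := (pairMap E₁ E₂).imageι ≫ pullback.fst E₁.πX E₂.πX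

/-- The second projection `p₂ : X₁₂ → X₂`. [cite: StacksProject, Tag 0F40 (proof)] -/
def p₂ : (pairMap E₁ E₂).image ⟶ E₂.X := (pairMap E₁ E₂).imageι ≫ pullback.snd E₁.πX E₂.πX

/-- `V₁₂ → X₁₂ → X₁` is `V₁₂ → V₁ ↪ X₁`. [folklore] -/
@[reassoc]
theorem toImage_p₁ : (pairMap E₁ E₂).toImage ≫ p₁ E₁ E₂ = pullback.fst E₁.ψ E₂.ψ ≫ E₁.V.ι := by
  rw [p₁, Scheme.Hom.toImage_imageι_assoc, pairMap_fst]

/-- `V₁₂ → X₁₂ → X₂` is `V₁₂ → V₂ ↪ X₂`. [folklore] -/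
@[reassoc]
theorem toImage_p₂ : (pairMap E₁ E₂).toImage ≫ p₂ E₁ E₂ = pullback.snd E₁.ψ E₂.ψ ≫ E₂.V.ι := by
  rw [p₂, Scheme.Hom.toImage_imageι_assoc, pairMap_snd]

/-- `p₁` is proper (`X₂ → S` is). [cite: StacksProject, Tag 0F40 (proof)] -/
instance isProper_p₁ : IsProper (p₁ E₁ E₂) := by unfold p₁; infer_instance

/-- `p₂` is proper (`X₁ → S` is). [cite: StacksProject, Tag 0F40 (proof)] -/
instance isProper_p₂ : IsProper (p₂ E₁ E₂) := by unfold p₂; infer_instance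

/-- The open `N₁ = V₁.ι(ψ₁⁻¹ U₂) ⊆ X₁` over which `p₁` is an isomorphism. [cite: StacksProject, Tag 0F40 (proof)] -/
def N₁ : E₁.X.Opens := E₁.V.ι ''ᵁ (E₁.ψ ⁻¹ᵁ U₂)

/-- `N₁` is the locus of `U₂`. [folklore] -/
theorem coe_N₁ : (N₁ E₁ (U₂ := U₂) : Set E₁.X) = E₁.locus (U₂ : Set U) := rfl

section IsoOverN

variable [CompactSpace (pullback E₁.ψ E₂.ψ : Scheme.{u})] [QuasiSeparatedSpace E₁.X]

/-- `V₁₂ → X₁ ×_S X₂` is quasi-compact (for `V₁₂` quasi-compact). [folklore] -/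
instance quasiCompact_pairMap : QuasiCompact (pairMap E₁ E₂) := by
  haveI : QuasiSeparatedSpace (pullback E₁.πX E₂.πX : Scheme.{u}) :=
    quasiSeparatedSpace_of_quasiSeparated (pullback.fst E₁.πX E₂.πX)
  infer_instance

/-- **`p₁ : X₁₂ → X₁` is an isomorphism over `N₁ = V₁.ι(ψ₁⁻¹ U₂)`** ("because `ψ₂` is an
isomorphism over `U₂` and `V₁₂ = V₁ ×_U V₂`"): `V₁₂ → V₁` is an isomorphism over `ψ₁⁻¹U₂`, and
the resulting section `N₁ ≅ V₁₂|_{N₁} → X₁₂|_{N₁}` of the separated `p₁` is scheme-theoretically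
dominant (`V₁₂ → X₁₂` is, and this is preserved by restriction over opens).
[cite: StacksProject, Tag 0F40 (proof)] -/
theorem isIso_p₁_restrict : IsIso (p₁ E₁ E₂ ∣_ N₁ E₁ (U₂ := U₂)) := by
  haveI := E₂.isIso_ψ
  haveI := Motives.isSchemeTheoreticallyDominant_toImage (pairMap E₁ E₂)
  set v := pairMap E₁ E₂ with hv
  set s := v.toImage with hs
  set fst' := pullback.fst E₁.ψ E₂.ψ with hfst'
  -- `V₁₂ → V₁` is an isomorphism over `ψ₁⁻¹ U₂`
  haveI hiso : IsIso (fst' ∣_ E₁.ψ ⁻¹ᵁ U₂) := isIso_morphismRestrict_pullback_fst E₁.ψ E₂.ψ U₂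
  -- the open `O' = fst'⁻¹(ψ₁⁻¹ U₂)` of `V₁₂` is `s⁻¹(p₁⁻¹ N₁)`
  have hO' : s ⁻¹ᵁ ((p₁ E₁ E₂) ⁻¹ᵁ N₁ E₁ (U₂ := U₂)) = fst' ⁻¹ᵁ (E₁.ψ ⁻¹ᵁ U₂) := by
    rw [← Scheme.Hom.comp_preimage, hs, toImage_p₁, Scheme.Hom.comp_preimage, N₁,
      E₁.V.ι.preimage_image_eq]
  -- the section `h : N₁ → p₁⁻¹(N₁)`
  set e : ↑(fst' ⁻¹ᵁ (E₁.ψ ⁻¹ᵁ U₂)) ⟶ (N₁ E₁ (U₂ := U₂) : Scheme.{u}) :=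
    (fst' ∣_ E₁.ψ ⁻¹ᵁ U₂) ≫ (E₁.V.ι.isoImage (E₁.ψ ⁻¹ᵁ U₂)).hom with he
  haveI : IsIso e := by rw [he]; infer_instance
  set h : (N₁ E₁ (U₂ := U₂) : Scheme.{u}) ⟶ ↑((p₁ E₁ E₂) ⁻¹ᵁ N₁ E₁ (U₂ := U₂)) :=
    inv e ≫ ((pullback E₁.ψ E₂.ψ).isoOfEq hO').inv ≫ (s ∣_ (p₁ E₁ E₂) ⁻¹ᵁ N₁ E₁ (U₂ := U₂)) with hh
  haveI : IsSchemeTheoreticallyDominant (s ∣_ (p₁ E₁ E₂) ⁻¹ᵁ N₁ E₁ (U₂ := U₂)) :=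
    IsSchemeTheoreticallyDominant.morphismRestrict s _
  haveI : IsSchemeTheoreticallyDominant h := by rw [hh]; infer_instance
  haveI : IsSeparated (p₁ E₁ E₂) := inferInstance
  refine isIso_morphismRestrict_of_section' (p₁ E₁ E₂) (N₁ E₁) h ?_
  -- `h` is a section: check after `N₁ ↪ X₁`
  rw [← cancel_mono (N₁ E₁ (U₂ := U₂)).ι, Category.id_comp, hh, Category.assoc, Category.assoc,
    Category.assoc, morphismRestrict_ι, ← Category.assoc (s ∣_ _), morphismRestrict_ι, Category.assoc,
    Scheme.isoOfEq_inv_ι_assoc, IsIso.inv_comp_eq, he, Category.assoc]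
  change (fst' ⁻¹ᵁ (E₁.ψ ⁻¹ᵁ U₂)).ι ≫ (pairMap E₁ E₂).toImage ≫ p₁ E₁ E₂ =
    (fst' ∣_ E₁.ψ ⁻¹ᵁ U₂) ≫ (E₁.V.ι.isoImage (E₁.ψ ⁻¹ᵁ U₂)).hom ≫ (E₁.V.ι ''ᵁ (E₁.ψ ⁻¹ᵁ U₂)).ι
  rw [toImage_p₁, Scheme.Hom.isoImage_hom_ι, ← Category.assoc (fst' ∣_ E₁.ψ ⁻¹ᵁ U₂), morphismRestrict_ι,
    Category.assoc]

end IsoOverN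

end ExtData

end Literature.AlgebraicGeometry.Morphisms

namespace Literature.AlgebraicGeometry.Morphisms

open Literature.AlgebraicGeometry.Resolution


/-- Two morphisms which agree after `b : X' → X` and land, after `b`, in an open `O` over which
`b` is an isomorphism, are equal (a private copy of `Resolution.ext_of_isIso_morphismRestrict`,
`GluingAfterBlowup.lean`, to keep this file's imports small). [folklore] -/
private theorem ext_of_isIso_morphismRestrict' {T X' X : Scheme.{u}} (b : X' ⟶ X) (O : X.Opens)
    [IsIso (b ∣_ O)] {a a' : T ⟶ X'} (h : a ≫ b = a' ≫ b) (hO : Set.range (a ≫ b) ⊆ (O : Set X)) : a = a' := by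
  have ha : Set.range a ⊆ Set.range (b ⁻¹ᵁ O).ι := by
    rw [Scheme.Opens.range_ι]
    rintro _ ⟨t, rfl⟩
    exact hO ⟨t, rfl⟩
  have ha' : Set.range a' ⊆ Set.range (b ⁻¹ᵁ O).ι := by
    rw [Scheme.Opens.range_ι]
    rintro _ ⟨t, rfl⟩
    show (a' ≫ b) t ∈ O
    rw [← h]
    exact hO ⟨t, rfl⟩
  rw [← IsOpenImmersion.lift_fac (b ⁻¹ᵁ O).ι a ha, ← IsOpenImmersion.lift_fac (b ⁻¹ᵁ O).ι a' ha']
  congr 1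
  rw [← cancel_mono (b ∣_ O), ← cancel_mono O.ι, Category.assoc, Category.assoc, morphismRestrict_ι,
    IsOpenImmersion.lift_fac_assoc, IsOpenImmersion.lift_fac_assoc, h]

/-! ## Images along equal morphisms and along isomorphisms of the source -/

/-- Equal morphisms have the same scheme-theoretic image. [folklore] -/
theorem exists_image_iso_of_eq {A B : Scheme.{u}} {φ₁ φ₂ : A ⟶ B} (h : φ₁ = φ₂) :
    ∃ e : φ₁.image ≅ φ₂.image, e.hom ≫ φ₂.imageι = φ₁.imageι := by
  subst h
  exact ⟨Iso.refl _, Category.id_comp _⟩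

/-- Precomposing with an isomorphism does not change the scheme-theoretic image. [folklore] -/
theorem exists_image_iso_of_isIso_comp {A A' B : Scheme.{u}} (κ : A' ⟶ A) [IsIso κ] (L : A ⟶ B) :
    ∃ e : (κ ≫ L).image ≅ L.image, e.hom ≫ L.imageι = (κ ≫ L).imageι := by
  have hker : L.imageι.ker = (κ ≫ L).imageι.ker := by
    rw [show L.imageι.ker = L.ker from Scheme.IdealSheafData.ker_subschemeι _,
      show (κ ≫ L).imageι.ker = (κ ≫ L).ker from Scheme.IdealSheafData.ker_subschemeι _,
      Scheme.Hom.ker_comp_of_isIso]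
  haveI := IsClosedImmersion.isIso_lift L.imageι (κ ≫ L).imageι hker
  exact ⟨asIso (IsClosedImmersion.lift L.imageι (κ ≫ L).imageι hker.le), IsClosedImmersion.lift_fac _ _ _⟩

namespace ExtData

variable {U S : Scheme.{u}} {g : U ⟶ S} {U₁ U₂ : U.Opens}

/-! ## Tag 0F3V: separating `Z̄ᵢ,ᵢ` from `Z̄ᵢ,ⱼ` -/

/-- **After a `Vᵢ`-admissible blowing up the closures of `Zᵢ,ᵢ = ψᵢ⁻¹(U ∖ Uⱼ)` and
`Zᵢ,ⱼ = ψᵢ⁻¹(U ∖ Uᵢ)` are disjoint** (Tag 0F3V applied to the disjoint constructible closed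
subsets `Zᵢ,ᵢ, Zᵢ,ⱼ` of `Vᵢ`). [cite: StacksProject, Tag 0F40 (proof)] -/
theorem exists_separating {Ui Uj : U.Opens} (E : ExtData g Ui) [CompactSpace E.X] [QuasiSeparatedSpace E.X]
    (hcov : Ui ⊔ Uj = ⊤) (hUi : IsCompact (Ui : Set U)) (hUj : IsCompact (Uj : Set U)) :
    ∃ (X' : Scheme.{u}) (β : X' ⟶ E.X) (C : E.X.IdealSheafData) (hβ : IsBlowup β C)
      (hCfg : ∀ W : E.X.affineOpens, (C.ideal W).FG) (hCV : Disjoint (E.V : Set E.X) (C.support : Set E.X)),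
      Disjoint (closure ((E.blowup β hβ hCfg hCV).locus (Uj : Set U)ᶜ))
        (closure ((E.blowup β hβ hCfg hCV).locus (Ui : Set U)ᶜ)) := by
  have hdiff : ∀ O : U.Opens, (E.V : Set E.X) \ E.locus (O : Set U)ᶜ = E.locus O := fun O => by
    rw [E.locus_compl, Set.sdiff_sdiff_cancel_left (E.locus_subset _)]
  have hdisj : Disjoint (E.locus (Uj : Set U)ᶜ) (E.locus (Ui : Set U)ᶜ) := by
    refine Set.disjoint_left.mpr ?_
    rintro _ ⟨v, hv, rfl⟩ h'
    rw [E.mem_locus_iff] at h'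
    have : E.ψ v ∈ ((Ui ⊔ Uj : U.Opens) : Set U) := by rw [hcov]; trivial
    rcases this with h | h
    · exact h' h
    · exact hv h
  obtain ⟨C, X', β, hCfg, hCV, hβ, hsep⟩ := stacks0F3V (X := E.X) E.V (E.locus (Uj : Set U)ᶜ)
    (E.locus (Ui : Set U)ᶜ) (E.locus_subset _) (E.locus_subset _)
    (by rw [hdiff]; exact E.isOpen_locus Uj.2) (by rw [hdiff]; exact E.isOpen_locus Ui.2)
    (by rw [hdiff]; exact E.isCompact_locus Uj hUj) (by rw [hdiff]; exact E.isCompact_locus Ui hUi) hdisj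
  refine ⟨X', β, C, hβ, hCfg, hCV, ?_⟩
  rw [E.blowup_locus, E.blowup_locus]
  exact hsep

/-! ## Tags 0F3W and 0F3Y: making `p₁` an isomorphism near `Z̄₁,₂` -/

section Near

variable (E₁ : ExtData g U₁) (E₂ : ExtData g U₂) [CompactSpace E₁.X] [QuasiSeparatedSpace E₁.X]
  [CompactSpace (pullback E₁.ψ E₂.ψ : Scheme.{u})]

set_option maxHeartbeats 800000 in
/-- **After a further (normalised) `V₁`-admissible blowing up, `p₁ : X₁₂ → X₁` is an isomorphism
over an open neighbourhood of `Z̄₁,₂`** (Tag 0F3W applied to the proper `p₁`, an isomorphism over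
`N₁ ⊇ Z₁,₂`; the new `X₁₂` is the strict transform of the old one by Tag 0F3Y).
[cite: StacksProject, Tag 0F40 (proof)] -/
theorem exists_isIso_near (hRG : Stacks081R.{u}) (hcov : U₁ ⊔ U₂ = ⊤) (hV₁ : IsCompact (E₁.V : Set E₁.X)) :
    ∃ (X₁' : Scheme.{u}) (b : X₁' ⟶ E₁.X) (Q : E₁.X.IdealSheafData) (hb : IsBlowup b Q)
      (hQfg : ∀ W : E₁.X.affineOpens, (Q.ideal W).FG) (hQV : Disjoint (E₁.V : Set E₁.X) (Q.support : Set E₁.X))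
      (N' : X₁'.Opens),
      closure ((E₁.blowup b hb hQfg hQV).locus (U₁ : Set U)ᶜ : Set X₁') ⊆ (N' : Set X₁') ∧
        IsIso (p₁ (E₁.blowup b hb hQfg hQV) E₂ ∣_ N') := by
  haveI := isIso_p₁_restrict E₁ E₂ (U₂ := U₂)
  -- Tag 0F3W for `p₁`, `V = V₁`, `T = Z₁,₂`, `N = N₁`
  have hTN : E₁.locus (U₁ : Set U)ᶜ ⊆ (N₁ E₁ (U₂ := U₂) : Set E₁.X) := by
    rw [coe_N₁]
    rintro _ ⟨v, hv, rfl⟩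
    refine ⟨v, ?_, rfl⟩
    have : E₁.ψ v ∈ ((U₁ ⊔ U₂ : U.Opens) : Set U) := by rw [hcov]; trivial
    rcases this with h | h
    · exact (hv h).elim
    · exact h
  obtain ⟨Q, X₁', b, N', hQfg, hQsupp, hb, hcl, hiso⟩ := stacks0F3W_of_stacks081R (p₁ E₁ E₂) E₁.V hV₁
    (E₁.locus (U₁ : Set U)ᶜ) (E₁.locus_subset _) (E₁.closure_locus_inter _ U₁.2.isClosed_compl)
    (N₁ E₁) (by rintro _ ⟨v, -, rfl⟩; exact v.2) hTN hRG
  have hQV : Disjoint (E₁.V : Set E₁.X) (Q.support : Set E₁.X) := by rw [hQsupp]; exact disjoint_compl_right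
  refine ⟨X₁', b, Q, hb, hQfg, hQV, N', ?_, ?_⟩
  · rw [E₁.blowup_locus]; exact hcl
  · /- Tag 0F3Y: the new `X₁₂` is the strict transform -/
    have hcc : centreCompl Q = E₁.V := centreCompl_eq_of_support_eq hQsupp
    haveI : IsIso (b ∣_ centreCompl Q) := by rw [hcc]; exact hb.isIso_morphismRestrict hQV
    haveI : QuasiCompact (centreCompl Q).ι := by
      rw [hcc]
      exact Limits.quasiCompact_ι_of_isCompact E₁.V hV₁
    set v := pairMap E₁ E₂ with hvdef
    have hv : Set.range (v ≫ pullback.fst E₁.πX E₂.πX) ⊆ (centreCompl Q : Set E₁.X) := by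
      rw [hcc, hvdef, pairMap_fst]
      rintro _ ⟨x, rfl⟩
      exact (pullback.fst E₁.ψ E₂.ψ x).2
    set L := liftToProduct E₁.πX E₂.πX b Q v hv with hL
    -- the comparison `κ : V₁' ×_U V₂ ≅ V₁ ×_U V₂`
    set E₁' := E₁.blowup b hb hQfg hQV with hE₁'
    haveI := E₁.isIso_restrict_of_blowup b hb hQV
    set κ : pullback E₁'.ψ E₂.ψ ⟶ pullback E₁.ψ E₂.ψ :=
      pullback.map E₁'.ψ E₂.ψ E₁.ψ E₂.ψ (b ∣_ E₁.V) (𝟙 _) (𝟙 U) (by rw [Category.comp_id]; rfl)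
        (by rw [Category.comp_id, Category.id_comp]) with hκ
    haveI : IsIso κ := by rw [hκ]; infer_instance
    -- `pairMap E₁' E₂ = κ ≫ L`
    have hκfst : κ ≫ pullback.fst E₁.ψ E₂.ψ = pullback.fst E₁'.ψ E₂.ψ ≫ (b ∣_ E₁.V) := by
      rw [hκ, pullback.lift_fst]
    have hκsnd : κ ≫ pullback.snd E₁.ψ E₂.ψ = pullback.snd E₁'.ψ E₂.ψ := by
      rw [hκ, pullback.lift_snd, Category.comp_id]
    -- components (definitional unfoldings of the blown-up data)
    have h1 : pairMap E₁' E₂ ≫ pullback.fst E₁'.πX E₂.πX = pullback.fst E₁'.ψ E₂.ψ ≫ (b ⁻¹ᵁ E₁.V).ι :=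
      pairMap_fst E₁' E₂
    have h2 : pairMap E₁' E₂ ≫ pullback.snd E₁'.πX E₂.πX = pullback.snd E₁'.ψ E₂.ψ ≫ E₂.V.ι :=
      pairMap_snd E₁' E₂
    have h3 : (κ ≫ L) ≫ pullback.fst E₁'.πX E₂.πX = κ ≫ liftToBlowup E₁.πX E₂.πX b Q v hv := by
      rw [Category.assoc]
      exact congrArg (κ ≫ ·) (liftToProduct_fst E₁.πX E₂.πX b Q v hv)
    have h4 : (κ ≫ L) ≫ pullback.snd E₁'.πX E₂.πX = κ ≫ v ≫ pullback.snd E₁.πX E₂.πX := by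
      rw [Category.assoc]
      exact congrArg (κ ≫ ·) (liftToProduct_snd E₁.πX E₂.πX b Q v hv)
    have hmap : pairMap E₁' E₂ = κ ≫ L := by
      apply pullback.hom_ext
      · -- both first components lift `fst ≫ (b|V₁) ≫ V₁.ι` along `b`, over `V₁`
        refine ext_of_isIso_morphismRestrict' b (centreCompl Q) ?_ ?_
        · rw [h1, h3, Category.assoc, Category.assoc, liftToBlowup_comp, hvdef, pairMap_fst,
            ← Category.assoc κ, hκfst, Category.assoc, ← morphismRestrict_ι]
        · rw [h1, hcc]
          rintro _ ⟨x, rfl⟩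
          exact (pullback.fst E₁'.ψ E₂.ψ x).2
      · rw [h2, h4, hvdef, pairMap_snd, ← Category.assoc κ, hκsnd]
    -- transport `IsIso` along the identifications of images
    obtain ⟨e₁, he₁⟩ := exists_image_iso_of_eq hmap
    obtain ⟨e₂, he₂⟩ := exists_image_iso_of_isIso_comp κ L
    have key : p₁ E₁' E₂ = (e₁.hom ≫ e₂.hom ≫ imageLiftToStrictTransform E₁.πX E₂.πX b Q v hv) ≫
        blowupStrictTransformMap (p₁ E₁ E₂) b Q := by
      have h5 : L.imageι ≫ pullback.fst E₁'.πX E₂.πX = imageLiftToStrictTransform E₁.πX E₂.πX b Q v hv ≫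
          blowupStrictTransformMap (v.imageι ≫ pullback.fst E₁.πX E₂.πX) b Q :=
        imageι_fst_eq E₁.πX E₂.πX b Q v hv
      rw [p₁, ← he₁, Category.assoc, ← he₂, Category.assoc, Category.assoc, Category.assoc, h5]
      rfl
    rw [key]
    haveI : IsIso ((e₁.hom ≫ e₂.hom ≫ imageLiftToStrictTransform E₁.πX E₂.πX b Q v hv) ∣_
        (blowupStrictTransformMap (p₁ E₁ E₂) b Q) ⁻¹ᵁ N') :=
      (MorphismProperty.isomorphisms.iff _).mp
        (IsZariskiLocalAtTarget.restrict ((MorphismProperty.isomorphisms.iff _).mpr inferInstance) _)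
    haveI := hiso
    exact isIso_morphismRestrict_comp _ _ N'

end Near

/-! ## `X₁₂ ∩ (Z̄₁,₂ ×_S Z̄₂,₁) = ∅` -/

section Empty

variable (E₁ : ExtData g U₁) (E₂ : ExtData g U₂)

/-- **`X₁₂ ∩ (Z̄₁,₂ ×_S Z̄₂,₁) = ∅`**: if `p₁` is an isomorphism over an open `N' ⊇ Z̄₁,₂` and
`Z̄₂,₂ ∩ Z̄₂,₁ = ∅`, no point of `X₁₂` lies over `Z̄₁,₂` and `Z̄₂,₁` ("the inverse image
`p₁⁻¹(Z̄₁,₂)` in `X₁₂` maps isomorphically to `Z̄₁,₂`. In particular `Z₁₂,₂` is dense in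
`p₁⁻¹(Z̄₁,₂)`. Thus `p₂` maps `p₁⁻¹(Z̄₁,₂)` into `Z̄₂,₂`. Since `Z̄₂,₂ ∩ Z̄₂,₁ = ∅` we conclude").
[cite: StacksProject, Tag 0F40 (proof)] -/
theorem pair_empty (hcov : U₁ ⊔ U₂ = ⊤) (N' : E₁.X.Opens)
    (hN' : closure (E₁.locus (U₁ : Set U)ᶜ) ⊆ (N' : Set E₁.X)) [IsIso (p₁ E₁ E₂ ∣_ N')]
    (hsep₂ : Disjoint (closure (E₂.locus (U₁ : Set U)ᶜ)) (closure (E₂.locus (U₂ : Set U)ᶜ)))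
    (z : (pairMap E₁ E₂).image) (hz : p₁ E₁ E₂ z ∈ closure (E₁.locus (U₁ : Set U)ᶜ)) :
    p₂ E₁ E₂ z ∉ closure (E₂.locus (U₂ : Set U)ᶜ) := by
  haveI := E₂.isIso_ψ
  set s := (pairMap E₁ E₂).toImage with hs
  set S₀ : Set (pairMap E₁ E₂).image :=
    s '' {x | E₁.ψ (pullback.fst E₁.ψ E₂.ψ x) ∈ (U₁ : Set U)ᶜ} with hS₀
  -- `p₁(s x) = V₁.ι (fst x)` and `p₂ (s x) = V₂.ι (snd x)`
  have hp₁s : ∀ x, p₁ E₁ E₂ (s x) = E₁.V.ι (pullback.fst E₁.ψ E₂.ψ x) := fun x => by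
    rw [← Scheme.Hom.comp_apply, hs, toImage_p₁, Scheme.Hom.comp_apply]
  have hp₂s : ∀ x, p₂ E₁ E₂ (s x) = E₂.V.ι (pullback.snd E₁.ψ E₂.ψ x) := fun x => by
    rw [← Scheme.Hom.comp_apply, hs, toImage_p₂, Scheme.Hom.comp_apply]
  have hψeq : ∀ x, E₁.ψ (pullback.fst E₁.ψ E₂.ψ x) = E₂.ψ (pullback.snd E₁.ψ E₂.ψ x) := fun x => by
    rw [← Scheme.Hom.comp_apply, pullback.condition, Scheme.Hom.comp_apply]
  -- (i) `p₁(S₀) = Z₁,₂`, with preimages: `p₁⁻¹(Z₁,₂) = S₀`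
  have hsurj : ∀ v : E₁.V, E₁.ψ v ∈ (U₁ : Set U)ᶜ → ∃ x, pullback.fst E₁.ψ E₂.ψ x = v := by
    intro v hv
    have hv₂ : E₁.ψ v ∈ U₂ := by
      have : E₁.ψ v ∈ ((U₁ ⊔ U₂ : U.Opens) : Set U) := by rw [hcov]; trivial
      rcases this with h | h
      · exact (hv h).elim
      · exact h
    have hψ₂ : E₂.ψ (E₂.sV ⟨E₁.ψ v, hv₂⟩) = E₁.ψ v := by
      rw [← Scheme.Hom.comp_apply, E₂.sV_ψ]; rfl
    obtain ⟨x, hx₁, -⟩ := Scheme.Pullback.Triplet.exists_preimage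
      (Scheme.Pullback.Triplet.mk' (f := E₁.ψ) (g := E₂.ψ) v (E₂.sV ⟨E₁.ψ v, hv₂⟩) hψ₂.symm)
    exact ⟨x, hx₁⟩
  have hinj : ∀ a b : (pairMap E₁ E₂).image, p₁ E₁ E₂ a ∈ N' → p₁ E₁ E₂ b ∈ N' →
      p₁ E₁ E₂ a = p₁ E₁ E₂ b → a = b := by
    intro a b ha hb hab
    have h := (ConcreteCategory.bijective_of_isIso (p₁ E₁ E₂ ∣_ N').base).1
      (a₁ := ⟨a, ha⟩) (a₂ := ⟨b, hb⟩) (Subtype.ext (by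
        rw [morphismRestrict_base_coe, morphismRestrict_base_coe]; exact hab))
    exact congrArg Subtype.val h
  have hpre : ∀ w : (pairMap E₁ E₂).image, p₁ E₁ E₂ w ∈ E₁.locus (U₁ : Set U)ᶜ → w ∈ S₀ := by
    rintro w ⟨v, hv, hw⟩
    obtain ⟨x, hx⟩ := hsurj v hv
    refine ⟨x, show E₁.ψ (pullback.fst E₁.ψ E₂.ψ x) ∈ (U₁ : Set U)ᶜ by rw [hx]; exact hv, ?_⟩
    refine hinj _ _ (hN' (subset_closure ?_)) (hN' (subset_closure ⟨v, hv, hw⟩)) ?_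
    · rw [hp₁s, hx]; exact ⟨v, hv, rfl⟩
    · rw [hp₁s, hx, hw]
  -- (ii) `z ∈ closure S₀`: transport along the homeomorphism `p₁⁻¹(N') ≅ N'`
  have hzN : p₁ E₁ E₂ z ∈ N' := hN' hz
  have hcl : z ∈ closure S₀ := by
    set φ := Scheme.homeoOfIso (asIso (p₁ E₁ E₂ ∣_ N')) with hφ
    have hφval : ∀ w : ↥((p₁ E₁ E₂) ⁻¹ᵁ N'), (φ w).1 = p₁ E₁ E₂ w.1 := fun w =>
      morphismRestrict_base_coe (p₁ E₁ E₂) N' w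
    -- in `N'`: the point lies in the closure of `Z₁,₂ ∩ N'`
    set T' : Set N' := N'.ι ⁻¹' E₁.locus (U₁ : Set U)ᶜ with hT'
    have h1 : (⟨p₁ E₁ E₂ z, hzN⟩ : N') ∈ closure T' := by
      rw [hT', ← N'.ι.isOpenEmbedding.isOpenMap.preimage_closure_eq_closure_preimage N'.ι.continuous]
      exact hz
    -- pull back along `φ`
    have h2 : φ ⁻¹' T' = ((p₁ E₁ E₂) ⁻¹ᵁ N').ι ⁻¹' S₀ := by
      ext w
      constructor
      · intro hw
        have hw' : p₁ E₁ E₂ w.1 ∈ E₁.locus (U₁ : Set U)ᶜ := by rw [← hφval]; exact hw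
        exact hpre _ hw'
      · rintro ⟨x, hx, hxw⟩
        show (φ w).1 ∈ E₁.locus (U₁ : Set U)ᶜ
        rw [hφval, show w.1 = s x from hxw.symm, hp₁s]
        exact ⟨_, hx, rfl⟩
    have h3 : (⟨z, hzN⟩ : ↥((p₁ E₁ E₂) ⁻¹ᵁ N')) ∈ closure (((p₁ E₁ E₂) ⁻¹ᵁ N').ι ⁻¹' S₀) := by
      rw [← h2, ← φ.preimage_closure]
      have : φ ⟨z, hzN⟩ = ⟨p₁ E₁ E₂ z, hzN⟩ := Subtype.ext (hφval _)
      show φ ⟨z, hzN⟩ ∈ closure T'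
      rw [this]; exact h1
    have h4 := image_closure_subset_closure_image ((p₁ E₁ E₂) ⁻¹ᵁ N').ι.continuous
      (s := ((p₁ E₁ E₂) ⁻¹ᵁ N').ι ⁻¹' S₀) ⟨_, h3, rfl⟩
    exact closure_mono (Set.image_preimage_subset _ _) h4
  -- (iii) `p₂(S₀) ⊆ Z₂,₂`, so `p₂ z ∈ Z̄₂,₂`, which misses `Z̄₂,₁`
  have h5 : p₂ E₁ E₂ z ∈ closure (E₂.locus (U₁ : Set U)ᶜ) := by
    have h := image_closure_subset_closure_image (p₂ E₁ E₂).continuous (s := S₀) ⟨z, hcl, rfl⟩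
    refine closure_mono ?_ h
    rintro _ ⟨_, ⟨x, hx, rfl⟩, rfl⟩
    rw [hp₂s]
    exact ⟨_, show E₂.ψ (pullback.snd E₁.ψ E₂.ψ x) ∈ (U₁ : Set U)ᶜ by rw [← hψeq]; exact hx, rfl⟩
  exact fun h6 => Set.disjoint_left.mp hsep₂ h5 h6

end Empty

/-! ## The two reductions combined -/

section GoodPair

/-- Properness over a quasi-compact base. [folklore] -/
theorem compactSpace_X [CompactSpace S] (E : ExtData g U₁) : CompactSpace E.X :=
  QuasiCompact.compactSpace_of_compactSpace E.πX

/-- Properness over a quasi-separated base. [folklore] -/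
theorem quasiSeparatedSpace_X [QuasiSeparatedSpace S] (E : ExtData g U₁) : QuasiSeparatedSpace E.X :=
  quasiSeparatedSpace_of_quasiSeparated E.πX

variable [CompactSpace S] [QuasiSeparatedSpace S]

/-- **The output of the two reductions of the proof of Tag 0F40**: starting from any extension
data for `U₁, U₂` (with `Vᵢ` quasi-compact, e.g. everything Noetherian) one obtains, by admissible
blowing ups, extension data `F₁, F₂` with `X₁₂ ∩ (Z̄₁,₂ ×_S Z̄₂,₁) = ∅`.
[cite: StacksProject, Tag 0F40 (proof)] -/
theorem exists_goodPair (hRG : Stacks081R.{u}) (hcov : U₁ ⊔ U₂ = ⊤) (hU₁ : IsCompact (U₁ : Set U))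
    (hU₂ : IsCompact (U₂ : Set U)) (E₁ : ExtData g U₁) (E₂ : ExtData g U₂)
    (hV : ∀ (Ui : U.Opens) (E : ExtData g Ui), IsCompact (E.V : Set E.X)) :
    ∃ (F₁ : ExtData g U₁) (F₂ : ExtData g U₂), ∀ z : (pairMap F₁ F₂).image,
      p₁ F₁ F₂ z ∈ closure (F₁.locus (U₁ : Set U)ᶜ) → p₂ F₁ F₂ z ∉ closure (F₂.locus (U₂ : Set U)ᶜ) := by
  haveI := compactSpace_X (U₁ := U₂) E₂
  haveI := quasiSeparatedSpace_X (U₁ := U₂) E₂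
  -- separate on `X₂`
  obtain ⟨X₂', β, C, hβ, hCfg, hCV, hsep₂⟩ := E₂.exists_separating (Uj := U₁) (by rw [sup_comm, hcov]) hU₂ hU₁
  set F₂ := E₂.blowup β hβ hCfg hCV with hF₂
  haveI := compactSpace_X E₁
  haveI := quasiSeparatedSpace_X E₁
  haveI := quasiSeparatedSpace_X (U₁ := U₂) F₂
  haveI : CompactSpace (F₂.V : Scheme.{u}) := isCompact_iff_compactSpace.mp (hV U₂ F₂)
  haveI : CompactSpace (pullback E₁.ψ F₂.ψ : Scheme.{u}) :=
    QuasiCompact.compactSpace_of_compactSpace (pullback.snd E₁.ψ F₂.ψ)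
  -- make `p₁` an isomorphism near `Z̄₁,₂`
  obtain ⟨X₁', b, Q, hb, hQfg, hQV, N', hN', hiso⟩ := exists_isIso_near E₁ F₂ hRG hcov (hV U₁ E₁)
  haveI := hiso
  exact ⟨E₁.blowup b hb hQfg hQV, F₂, fun z hz => pair_empty _ F₂ hcov N' hN' hsep₂ z hz⟩

end GoodPair

end ExtData

end Literature.AlgebraicGeometry.Morphisms

end
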